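import Summits.QuantumFields.YangMills.Theorems.BalabanUVNodesN15VectorPieceReadoutFull
import HarnessLib

/-!
# Route «BalabanUVNodes» (K4 «SpineRates»), node N15 = NE2, -a lane, part 26: THE PLAIN (UNDIFFERENCED) BLOCK MAJORANTS OF THE U = 1 VECTOR PIECE —
# `G = H_k·C^{(k)}·(η^{d+1}H_kᵀ)`, its fine twin `G′`, `G∂_ν*`, `∂′_νG′`, `(Δ′−∂′∂′*)G′` have uniform majorants `β·e^{−ρ|y−y′|_T}` on the unit-torus carrier

Cell `pub-ymgap`, seat `pub-ymgap-dag-n15-a` (KNIT-BY-NAME, generation g5; HUMAN RULING D-0062; chair R424 venue; `bears_on: R4∕N15`).  Filed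
`--supports stmt-QuantumFields-19351` (helper).  THEOREMS ONLY; imports BY NAME, nothing in the tree modified: part 23 (transitively parts 15∕21: the plumbing
`reH`∕`reD`∕`reLap`∕`covC`∕`wTranspose`∕`rweight`∕`blkFine`∕`kingPr(V)` and their `_single` entry lemmas, `lapker_bounds`), part 9 (`norm_HkOp_le_tdistT`), part 12
(`norm_dker_le_tdistT`), part 1 (`hasMaj_ofBlocks_of_entry_le`), the (2.156) lineage (`T4Cov2156Rate.cov2156_pair_torus`), the [B6] carrier
(`B6UnitTorusCarrier`: `unitTorusGeo`, (2.54), (2.61), block counts, `pdist_rep_rep`), the weighted-norm calculus `B9SectDWeightedNeumann` (`WRow`, `wrow_of_exp`,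
`hasMaj_comp_wrow`), King's `blockOf_over`, `exp_decay_mono`.

WHY (the JOINT -a∕-b residue, pub-ymgap INBOX: n15-b g5 LANDED-A3∕A4 line; ref-B READ-342 table note (2)).  n15-b's background layer BY NAME
(`…N15.BackgroundLayer.ne2PlusOperator_background4`, part A4) displays as its ONLY hypotheses the U ≡ 1 layer: (a) PLAIN decaying block majorants `β·e^{−δd}` of
the coarse piece `G`, its fine twin `G′`, the source piece `S = G∂_ν*`, and the fine derived pieces `D₁′ = ∂′_νG′`, `D₃′ = (Δ′−∂′∂′*)G′`; (b) the four η-defects with a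
rate.  (b) is parts 15∕16∕23 (`hasMaj_entry0…3`).  (a) was so far INTERNAL to parts 9∕12∕13∕22 (the `hdecH`∕`hKmaj`∕`hCK` steps of the defect assembly); this
file EXPORTS it: one generic three-factor composition lemma (§1), the entry decays of the five factors by name (§2), and the five plain majorants on the concrete
carrier with ONE uniform `(β, δ_p)` (§3).  Part 27 (the joint knit) then instantiates A4 at these pieces.

CONTENTS.
* §1 **`hasMaj_comp3_plain`**: on any [B6] carrier ((2.54), `d ≥ 0` symmetric, (2.61) at `σ` with constant `c_r`),
  block assignments `blkΩ` (unit bonds, `≤ n_Ω` per site), `blk₁` (source fine bonds, `≤ n₁` per site), `blk₂` (target fine bonds): entry decays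
  `|A(δ_b)(i)| ≤ a·e^{−δd}`, `|C(δ_{b′})(b)| ≤ c·e^{−δd}`, `|K(δ_i)(b)| ≤ κ·e^{−δd}` and `ρ + σ ≤ δ` ⇒
  `HasMaj (ofBlocks g blk₁) (ofBlocks g blk₂) (A ∘ₗ (C ∘ₗ K)) ((n_Ω a c_r)·((n_Ω c c_r)·(n₁ κ))·e^{−ρd})`.
* §2 `abs_reH_single_le` (part 9), `abs_reD_single_le` (part 12), `exists_abs_reLap_single_le` (part 21), `exists_abs_covC_single_le` ((2.156) lineage),
  `abs_wTranspose_single`; `blkFine_apply`, `blkFine_comp_kingPrV` (`blkFine L k M ∘ kingPrV L k m M = fun i′ ↦ B_{k+m}(i′)`, King's `blockOf_over`),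
  `fineBond_weight_balance` (`(d+1)·n^{d+1}·w ≤ d+1` for the two Riemann weights).
* §3 **`hasMaj_plain_unitTorus`** (level-`n` composite `A ∘ covC ∘ wTranspose w B` on `unitTorusGeo L k M` with blocks `B_n(·)`), and the five pieces with ONE
  uniform pair `(β, δ_p)`: **`hasMaj_plain_all`** — `G_k` (blocks `blkFine`), `G′` (level `L^mL^k`, weight `η^{d+1}∕(L^m)^{d+1}`, blocks `blkFine ∘ kingPrV`),
  `S = G_k∂_ν*`, `D₁′ = ∂′_νG′`, `D₃′ = (Δ′−∂′∂′*)G′`, for every unit torus `Π ℤ∕M_ν` with `L ∣ M_ν`, all `k`, `m`, `ν`, `0 ≤ ρ ≤ δ_p` (one five-fold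
  conjunction; consumers project).

HONEST FRAMING ∕ LIMITS.  Re-packaging of LANDED decay theorems (b05 `H_k` decay, its derivative and Laplacian kernels, the (2.156) covariance decay) as block
majorants through [B6] (2.52)–(2.55) bookkeeping; no new estimate.  `U = 1` LINEAR theory on FINITE tori, one single-scale piece in King's (4.42) shape; NOT the
multiscale carrier ∕ telescoping over `j` (NODE 00); NE2⁺ proper (U ≠ 1) NOT PRINTED ∕ not proved.  Count-neutral (typed 28∕28 · discharged unchanged); NOT a
discharge of N15; one finite T⁴ at fixed ε — NOT infinite volume, NOT OS on ℝ⁴, NOT a mass gap, NOT Clay.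
-/

noncomputable section

open scoped BigOperators
open Finset

namespace Summit.QuantumFields.YangMills.BalabanUVNodes.N15.VectorPiece

open Literature.MathematicalPhysics.QuantumFieldTheory.Balaban1983to89
open Literature.MathematicalPhysics.QuantumFieldTheory.Balaban1983to89.B11SectG (BlockNorm HasMaj RowSum)
open Literature.MathematicalPhysics.QuantumFieldTheory.Balaban1983to89.B6RandomWalk (Triangle254)
open Literature.MathematicalPhysics.QuantumFieldTheory.Balaban1983to89.B9SectDWeightedNeumann (WRow wrow_of_exp hasMaj_comp_wrow)
open Literature.MathematicalPhysics.QuantumFieldTheory.Balaban1983to89.T4EtaRateCoeffDefect (fibre)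
open Literature.MathematicalPhysics.QuantumFieldTheory.Balaban1983to89.B4TorusKernel (periodConst)
open Literature.MathematicalPhysics.QuantumFieldTheory.Balaban1983to89.B5Prop11Plancherel (Tor fine)
open Literature.MathematicalPhysics.QuantumFieldTheory.Balaban1983to89.B5Hk163Strip (kappa163 kappa163_pos)
open Literature.MathematicalPhysics.QuantumFieldTheory.Balaban1983to89.B5Hk163Decay (MG163)
open Literature.MathematicalPhysics.QuantumFieldTheory.Balaban1983to89.B5Hk163Torus (HkOp)
open Literature.MathematicalPhysics.QuantumFieldTheory.Balaban1983to89.B5Hk163RDiv (DstarD)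
open Literature.MathematicalPhysics.QuantumFieldTheory.Balaban1983to89.B5Hk163TorusHolderDecay (MD163)
open Literature.MathematicalPhysics.QuantumFieldTheory.Balaban1983to89.B6LowerBound2153Torus (rep rep_mem_pbox)
open Literature.MathematicalPhysics.QuantumFieldTheory.Balaban1983to89.B6Lemma24Torus (pbox)
open Literature.MathematicalPhysics.QuantumFieldTheory.Balaban1983to89.B6Cov2156Torus (deltaPol bondReductionT one_le_M)
open Literature.MathematicalPhysics.QuantumFieldTheory.Balaban1983to89.B6UnitTorusCarrier (unitTorusGeo unitTorusGeo_dist triangle254_unitTorusGeo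
  unitTorusGeo_dist_nonneg unitTorusGeo_dist_symm rowSum_unitTorusGeo card_fibre_unitBond card_fibre_fineBond pdist_rep_rep)
open Literature.MathematicalPhysics.QuantumFieldTheory.Balaban1983to89.T4Cov2156Rate (cov2156_pair_torus)
open Literature.MathematicalPhysics.QuantumFieldTheory.King1986 (exp_decay_mono)
open Literature.MathematicalPhysics.QuantumFieldTheory.King1986.Torus (blockOf tdistT tdistT_nonneg tdistT_symm blockOf_over)
open Summit.QuantumFields.YangMills.BalabanUVNodes.N15.DefectKernel (hasMaj_ofBlocks_of_entry_le norm_HkOp_le_tdistT norm_dker_le_tdistT)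

variable {d : ℕ}

/-! ## §1 Generic: the plain block majorant of a three-factor composite `A ∘ C ∘ K` from entry decays -/

section Generic

variable {g : B6.Geometry} [DecidableEq g.Site] {XΩ X₁ X₂ : Type} [Fintype XΩ] [DecidableEq XΩ] [Fintype X₁] [DecidableEq X₁]
  [Fintype X₂]

/-- **THE PLAIN MAJORANT OF A THREE-FACTOR COMPOSITE.**  On a [B6] carrier ((2.54); `d ≥ 0`, symmetric; (2.61) at `σ` with constant `c_r ≥ 0`), with unit
bonds `XΩ` assigned to sites by `blkΩ` (`≤ n_Ω` per site), source fine bonds `X₁` by `blk₁` (`≤ n₁` per site) and target fine bonds `X₂` by `blk₂`: if the left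
factor `A : unit → fine`, the unit operator `C` and the right factor `K : fine → unit` have entry decays `a·e^{−δd}`, `c·e^{−δd}`, `κ·e^{−δd}` and `ρ + σ ≤ δ`, then
`A ∘ C ∘ K` has the block majorant `(n_Ω a c_r)·((n_Ω c c_r)·(n₁ κ))·e^{−ρ d(y,y′)}` ([B6] (2.52)–(2.55): products of kernels with exponential decay keep the
decay, losing the row-sum constant per composition). [cite: Balaban1984PropagatorsII, (2.52)–(2.55) pp.232–233, Lemma 2.1 (2.61) p.234] -/
theorem hasMaj_comp3_plain (htri : Triangle254 g) (hdist : ∀ y y' : g.Site, 0 ≤ g.dist y y') (hsymm : ∀ y y' : g.Site, g.dist y y' = g.dist y' y)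
    {σ cr : ℝ} (hσ : 0 ≤ σ) (hcr : 0 ≤ cr) (hrow : RowSum g σ cr)
    (blkΩ : XΩ → g.Site) {nΩ : ℕ} (hnΩ : ∀ y', (fibre blkΩ y').card ≤ nΩ)
    (blk₁ : X₁ → g.Site) {n₁ : ℕ} (hn₁ : ∀ y', (fibre blk₁ y').card ≤ n₁) (blk₂ : X₂ → g.Site)
    {A : (XΩ → ℝ) →ₗ[ℝ] (X₂ → ℝ)} {C : (XΩ → ℝ) →ₗ[ℝ] (XΩ → ℝ)} {K : (X₁ → ℝ) →ₗ[ℝ] (XΩ → ℝ)}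
    {a c κ δ ρ : ℝ} (ha : 0 ≤ a) (hc : 0 ≤ c) (hκ : 0 ≤ κ) (hρ : 0 ≤ ρ) (hρδ : ρ + σ ≤ δ)
    (hA : ∀ (b : XΩ) (i : X₂), |A (Pi.single b 1) i| ≤ a * Real.exp (-(δ * g.dist (blkΩ b) (blk₂ i))))
    (hC : ∀ b b' : XΩ, |C (Pi.single b' 1) b| ≤ c * Real.exp (-(δ * g.dist (blkΩ b) (blkΩ b'))))
    (hK : ∀ (i : X₁) (b : XΩ), |K (Pi.single i 1) b| ≤ κ * Real.exp (-(δ * g.dist (blkΩ b) (blk₁ i)))) :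
    HasMaj (BlockNorm.ofBlocks g blk₁) (BlockNorm.ofBlocks g blk₂) (A ∘ₗ (C ∘ₗ K))
      (fun y y' => (nΩ * a * cr) * ((nΩ * c * cr) * (n₁ * κ)) * Real.exp (-(ρ * g.dist y y'))) := by
  have hρδ' : ρ ≤ δ := by linarith
  -- the right factor `K`: `n₁ κ e^{−ρd}`
  have hKmaj : HasMaj (BlockNorm.ofBlocks g blk₁) (BlockNorm.ofBlocks g blkΩ) K (fun y y' => n₁ * κ * Real.exp (-(ρ * g.dist y y'))) := by
    have key := hasMaj_ofBlocks_of_entry_le blk₁ blkΩ (T := K) (κ := fun y y' => κ * Real.exp (-(ρ * g.dist y y')))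
      (fun _ _ => mul_nonneg hκ (Real.exp_nonneg _)) hn₁ fun b i => (hK i b).trans (exp_decay_mono hκ hρδ' (hdist _ _))
    exact key.mono fun y y' => le_of_eq (by ring)
  -- the unit operator `C`: `nΩ c e^{−δd}`, weighted row norm `nΩ c c_r`
  have hCmaj : HasMaj (BlockNorm.ofBlocks g blkΩ) (BlockNorm.ofBlocks g blkΩ) C (fun y y' => nΩ * (c * Real.exp (-(δ * g.dist y y')))) :=
    hasMaj_ofBlocks_of_entry_le blkΩ blkΩ (T := C) (κ := fun y y' => c * Real.exp (-(δ * g.dist y y')))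
      (fun _ _ => mul_nonneg hc (Real.exp_nonneg _)) hnΩ fun b b' => hC b b'
  have hCwrow : WRow g ρ (fun y y' => nΩ * (c * Real.exp (-(δ * g.dist y y')))) (nΩ * c * cr) := by
    have h := wrow_of_exp (ρ := ρ) (θ := nΩ * c) (δ := δ) hdist hrow (mul_nonneg (Nat.cast_nonneg _) hc) hρδ
    exact h.mono fun y y' => le_of_eq (by ring)
  -- `C ∘ K`
  have hCK : HasMaj (BlockNorm.ofBlocks g blk₁) (BlockNorm.ofBlocks g blkΩ) (C ∘ₗ K)
      (fun y y' => (BlockNorm.ofBlocks g blkΩ).κ * (nΩ * c * cr) * (n₁ * κ) * Real.exp (-(ρ * g.dist y y'))) :=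
    hasMaj_comp_wrow htri hρ (mul_nonneg (Nat.cast_nonneg _) hκ)
      (fun _ _ => mul_nonneg (Nat.cast_nonneg _) (mul_nonneg hc (Real.exp_nonneg _))) hCwrow hCmaj hKmaj
  rw [show (BlockNorm.ofBlocks g blkΩ).κ = 1 from rfl, one_mul] at hCK
  -- the left factor `A`: `nΩ a e^{−δd}`, weighted row norm `nΩ a c_r`
  have hAmaj : HasMaj (BlockNorm.ofBlocks g blkΩ) (BlockNorm.ofBlocks g blk₂) A (fun y y' => nΩ * (a * Real.exp (-(δ * g.dist y y')))) :=
    hasMaj_ofBlocks_of_entry_le blkΩ blk₂ (T := A) (κ := fun y y' => a * Real.exp (-(δ * g.dist y y')))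
      (fun _ _ => mul_nonneg ha (Real.exp_nonneg _)) hnΩ fun i b => by rw [hsymm]; exact hA b i
  have hAwrow : WRow g ρ (fun y y' => nΩ * (a * Real.exp (-(δ * g.dist y y')))) (nΩ * a * cr) := by
    have h := wrow_of_exp (ρ := ρ) (θ := nΩ * a) (δ := δ) hdist hrow (mul_nonneg (Nat.cast_nonneg _) ha) hρδ
    exact h.mono fun y y' => le_of_eq (by ring)
  -- `A ∘ (C ∘ K)`
  have hCK0 : 0 ≤ nΩ * c * cr * (n₁ * κ) := by positivity
  have key := hasMaj_comp_wrow htri hρ hCK0 (fun _ _ => mul_nonneg (Nat.cast_nonneg _) (mul_nonneg ha (Real.exp_nonneg _))) hAwrow hAmaj hCK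
  rw [show (BlockNorm.ofBlocks g blkΩ).κ = 1 from rfl, one_mul] at key
  exact key

end Generic

/-! ## §2 The entry decays of the five factors, by name, and the block bookkeeping -/

section Entries

variable (M : Fin (d + 1) → ℕ) [hM : ∀ μ, NeZero (M μ)] (n : ℕ) [NeZero n]

/-- `|H_k((x,μ),(y,λ))| ≤ c₀·e^{−δ_H|B(x)−y|_T}` for the real linear map `reH` (part 9 `norm_HkOp_le_tdistT`; `c₀ = MG163·periodConst`, `δ_H = κ₁₆₃∕(d+1)`).
[cite: Balaban1984PropagatorsI, (1.63) p.28, p.38 (decay method)] -/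
theorem abs_reH_single_le (b : Tor M × Fin (d + 1)) (i : Tor (fine n M) × Fin (d + 1)) :
    |reH M n (Pi.single b 1) i| ≤ MG163 (d + 1) * periodConst (kappa163 (d + 1)) d *
      Real.exp (-(kappa163 (d + 1) / (d + 1) * tdistT M (blockOf n M i.1) b.1)) := by
  rw [reH_single]
  exact (Complex.abs_re_le_norm _).trans (norm_HkOp_le_tdistT n M i.2 b.2 i.1 b.1)

/-- `|∂_νH_k((x,μ),(y,λ))| ≤ c_D·e^{−δ_H|B(x)−y|_T}` for `reD ν` (part 12 `norm_dker_le_tdistT`; `c_D = MD163·periodConst`). [cite: Balaban1984PropagatorsI, (1.63) p.28, (1.31) p.23] -/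
theorem abs_reD_single_le (ν : Fin (d + 1)) (b : Tor M × Fin (d + 1)) (i : Tor (fine n M) × Fin (d + 1)) :
    |reD M n ν (Pi.single b 1) i| ≤ MD163 (d + 1) * periodConst (kappa163 (d + 1)) d *
      Real.exp (-(kappa163 (d + 1) / (d + 1) * tdistT M (blockOf n M i.1) b.1)) := by
  rw [reD_single]
  exact (Complex.abs_re_le_norm _).trans (norm_dker_le_tdistT n M ν i.2 b.2 i.1 b.1)

omit hM [NeZero n] M n in
/-- `|((Δ−∂∂*)H_k)((x,μ),(y,λ))| ≤ c_F·e^{−δ_F|B(x)−y|_T}` for `reLap`, constants uniform in the torus and the level (part 21 `lapker_bounds`).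
[cite: Balaban1984PropagatorsI, (1.63) p.28, (1.65)–(1.66) p.29, (1.69) p.29] -/
theorem exists_abs_reLap_single_le :
    ∃ cF δF : ℝ, 0 < cF ∧ 0 < δF ∧ ∀ (M : Fin (d + 1) → ℕ) [∀ μ, NeZero (M μ)] (n : ℕ) [NeZero n]
      (b : Tor M × Fin (d + 1)) (i : Tor (fine n M) × Fin (d + 1)),
      |reLap M n (Pi.single b 1) i| ≤ cF * Real.exp (-(δF * tdistT M (blockOf n M i.1) b.1)) := by
  obtain ⟨cF, CF, δF, hcF, hCF, hδF, H⟩ := lapker_bounds (d := d)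
  refine ⟨cF, δF, hcF, hδF, fun M _ n _ b i => ?_⟩
  rw [reLap_single]
  exact (H M n).1 i.1 i.2 b.1 b.2

omit hM [NeZero n] M n in
/-- `|C^{(k)}(b, b′)| ≤ B₀·e^{−δ₀|y−y′|_T}` for `covC` at every level `L^kk`, constants uniform (the (2.156) lineage's `cov2156_pair_torus`, read at base points by
`pdist_rep_rep`). [cite: Balaban1984PropagatorsII, (2.156) p.250; King1986, Lemma 4.5 (4.38) p.674 (shape)] -/
theorem exists_abs_covC_single_le (hd : 1 ≤ d) {L : ℕ} (hL : 1 ≤ L) :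
    ∃ B₀ δ₀ : ℝ, 0 < B₀ ∧ 0 < δ₀ ∧ ∀ (M : Fin (d + 1) → ℕ) [∀ μ, NeZero (M μ)] (_ : ∀ i, L ∣ M i) (kk : ℕ) (b b' : Tor M × Fin (d + 1)),
      |covC L M (L ^ kk) (Pi.single b' 1) b| ≤ B₀ * Real.exp (-(δ₀ * tdistT M b.1 b'.1)) := by
  obtain ⟨B₀, δ₀, hB₀, hδ₀, HP⟩ := cov2156_pair_torus (d := d + 1) (by omega) hL
  refine ⟨B₀, δ₀, hB₀, hδ₀, fun M _ hLM kk b b' => ?_⟩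
  rw [covC_single]
  have h := (HP M hLM kk (⟨rep M b.1, rep_mem_pbox M b.1⟩, b.2) (⟨rep M b'.1, rep_mem_pbox M b'.1⟩, b'.2)).1
  rwa [pdist_rep_rep] at h

/-- Entries of the weighted transpose, absolute values: `|K(δ_i)(b)| = w·|A(δ_b)(i)|` (`w ≥ 0`). [folklore] -/
theorem abs_wTranspose_single {w : ℝ} (hw : 0 ≤ w) (A : (Tor M × Fin (d + 1) → ℝ) →ₗ[ℝ] (Tor (fine n M) × Fin (d + 1) → ℝ))
    (i : Tor (fine n M) × Fin (d + 1)) (b : Tor M × Fin (d + 1)) :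
    |wTranspose M n w A (Pi.single i 1) b| = w * |A (Pi.single b 1) i| := by
  rw [wTranspose_single, abs_mul, abs_of_nonneg hw]

omit [NeZero n] n in
/-- `blkFine` is the unit block of the base point. [folklore] -/
theorem blkFine_apply (L k : ℕ) [NeZero L] (i : Tor (fine (L ^ k) M) × Fin (d + 1)) : blkFine L k M i = blockOf (L ^ k) M i.1 := rfl

omit [NeZero n] n in
/-- Through King's pairing the fine bonds of the fine run land in the unit block of their own base point: `blkFine L k M ∘ kingPrV L k m M = (i′ ↦ B_{k+m}(i′))`
(King's `blockOf_over`). [cite: King1986, p.664 («When x′ ∈ T_{η′}, we denote by x that point in T_η for which x′ ∈ B^n(x)»)] -/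
theorem blkFine_comp_kingPrV (L k m : ℕ) [NeZero L] :
    blkFine L k M ∘ kingPrV L k m M = fun i' : Tor (fine (L ^ m * L ^ k) M) × Fin (d + 1) => blockOf (L ^ m * L ^ k) M i'.1 := by
  funext i'
  show blockOf (L ^ k) M (kingPrV L k m M i').1 = blockOf (L ^ m * L ^ k) M i'.1
  rw [kingPrV_eq]
  exact (blockOf_over M (kingPr L k m M i'.1) i'.1 (fun μ => kingPr_val L k m M i'.1 μ)).symm

omit hM [NeZero n] M n in
/-- The Riemann balance as an inequality: `(d+1)·(L^k)^{d+1}·η^{d+1} ≤ d+1` (`η = L^{−k}`; equality). [folklore] -/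
theorem fineBond_weight_balance {L : ℕ} (hL : L ≠ 0) (k : ℕ) :
    ((((d + 1) * (L ^ k) ^ (d + 1) : ℕ) : ℝ)) * rweight (d := d) L k ≤ ((d + 1 : ℕ) : ℝ) :=
  (card_mul_rweight (d := d) hL k).le

omit hM [NeZero n] M n in
/-- The Riemann balance for the fine run read at the coarse weight: `(d+1)·(L^mL^k)^{d+1}·(η^{d+1}∕(L^m)^{d+1}) ≤ d+1` (equality). [folklore] -/
theorem fineBond_weight_balance_fine {L : ℕ} (hL : L ≠ 0) (k m : ℕ) :
    ((((d + 1) * (L ^ m * L ^ k) ^ (d + 1) : ℕ) : ℝ)) * (rweight (d := d) L k / ((L : ℝ) ^ m) ^ (d + 1)) ≤ ((d + 1 : ℕ) : ℝ) := by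
  rw [rweight_div]
  have h := card_mul_rweight (d := d) hL (k + m)
  have hLL : L ^ m * L ^ k = L ^ (k + m) := by rw [Nat.pow_add, Nat.mul_comm]
  have hcast : ((((d + 1) * (L ^ m * L ^ k) ^ (d + 1) : ℕ) : ℝ)) = ((((d + 1) * (L ^ (k + m)) ^ (d + 1) : ℕ) : ℝ)) := by
    rw [hLL]
  rw [hcast]
  exact h.le

end Entries

/-! ## §3 The five plain majorants on the concrete unit-torus carrier, ONE uniform `(β, δ_p)` -/

section Concrete

/-- **THE LEVEL-`n` COMPOSITE ON THE CONCRETE CARRIER.**  On `unitTorusGeo L k M` with the level-`n` fine bonds assigned to the unit block of their base point and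
the unit bonds to their base point: if `A`, `B : unit → fine` have entry decays `a·e^{−δ_A|B(x)−y|_T}`, `b·e^{−δ_B|B(x)−y|_T}`, the covariance `covC L M (L^kk)` has
`B₀·e^{−δ₀|y−y′|_T}`, the weight satisfies `(d+1)n^{d+1}·w ≤ d+1`, and `0 < σ`, `ρ + σ ≤ min(δ_A, δ_B, δ₀)`, then `A ∘ covC ∘ (w·Bᵀ)` has the block majorant
`((d+1) a K_σ)·((d+1) B₀ K_σ)·((d+1) b)·e^{−ρ|y−y′|_T}` (`K_σ = K_{d+1}(σ)` the volume-independent (2.61) constant). [cite: Balaban1984PropagatorsII, (2.52)–(2.55) pp.232–233, Lemma 2.1 (2.61) p.234; King1986, (4.42) p.675 (the piece)] -/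
theorem hasMaj_plain_unitTorus {L : ℕ} (M : Fin (d + 1) → ℕ) [∀ μ, NeZero (M μ)] (k kk n : ℕ) [NeZero n]
    {B₀ δ₀ : ℝ} (hB₀ : 0 ≤ B₀)
    (hC : ∀ b b' : Tor M × Fin (d + 1), |covC L M (L ^ kk) (Pi.single b' 1) b| ≤ B₀ * Real.exp (-(δ₀ * tdistT M b.1 b'.1)))
    {A B : (Tor M × Fin (d + 1) → ℝ) →ₗ[ℝ] (Tor (fine n M) × Fin (d + 1) → ℝ)} {a δA b₀ δB : ℝ} (ha : 0 ≤ a) (hb : 0 ≤ b₀)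
    (hA : ∀ (b : Tor M × Fin (d + 1)) (i : Tor (fine n M) × Fin (d + 1)), |A (Pi.single b 1) i| ≤ a * Real.exp (-(δA * tdistT M (blockOf n M i.1) b.1)))
    (hB : ∀ (b : Tor M × Fin (d + 1)) (i : Tor (fine n M) × Fin (d + 1)), |B (Pi.single b 1) i| ≤ b₀ * Real.exp (-(δB * tdistT M (blockOf n M i.1) b.1)))
    {w : ℝ} (hw : 0 ≤ w) (hbal : ((((d + 1) * n ^ (d + 1) : ℕ) : ℝ)) * w ≤ ((d + 1 : ℕ) : ℝ))
    {σ ρ : ℝ} (hσ : 0 < σ) (hρ : 0 ≤ ρ) (hρA : ρ + σ ≤ δA) (hρB : ρ + σ ≤ δB) (hρC : ρ + σ ≤ δ₀) :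
    HasMaj (BlockNorm.ofBlocks (unitTorusGeo L k M) (fun i : Tor (fine n M) × Fin (d + 1) => blockOf n M i.1))
      (BlockNorm.ofBlocks (unitTorusGeo L k M) (fun i : Tor (fine n M) × Fin (d + 1) => blockOf n M i.1))
      (A ∘ₗ (covC L M (L ^ kk) ∘ₗ wTranspose M n w B))
      (fun y y' => (((d + 1 : ℕ) : ℝ) * a * B4Sect5Proof.latticeConst (d + 1) σ) *
          ((((d + 1 : ℕ) : ℝ) * B₀ * B4Sect5Proof.latticeConst (d + 1) σ) * (((d + 1 : ℕ) : ℝ) * b₀)) * Real.exp (-(ρ * tdistT M y y'))) := by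
  have hcr0 : 0 ≤ B4Sect5Proof.latticeConst (d + 1) σ := B4Sect5Proof.latticeConst_nonneg (d + 1) hσ.le
  -- all decays weakened to the common rate `ρ + σ`
  have hA' : ∀ (b : Tor M × Fin (d + 1)) (i : Tor (fine n M) × Fin (d + 1)),
      |A (Pi.single b 1) i| ≤ a * Real.exp (-((ρ + σ) * (unitTorusGeo L k M).dist b.1 (blockOf n M i.1))) := fun b i =>
    (hA b i).trans (by rw [unitTorusGeo_dist, tdistT_symm M b.1]; exact exp_decay_mono ha hρA (tdistT_nonneg _ _ _))
  have hC' : ∀ b b' : Tor M × Fin (d + 1),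
      |covC L M (L ^ kk) (Pi.single b' 1) b| ≤ B₀ * Real.exp (-((ρ + σ) * (unitTorusGeo L k M).dist b.1 b'.1)) := fun b b' =>
    (hC b b').trans (exp_decay_mono hB₀ hρC (tdistT_nonneg _ _ _))
  have hK' : ∀ (i : Tor (fine n M) × Fin (d + 1)) (b : Tor M × Fin (d + 1)),
      |wTranspose M n w B (Pi.single i 1) b| ≤ w * b₀ * Real.exp (-((ρ + σ) * (unitTorusGeo L k M).dist b.1 (blockOf n M i.1))) := fun i b => by
    rw [abs_wTranspose_single M n hw, mul_assoc]
    refine mul_le_mul_of_nonneg_left ((hB b i).trans ?_) hw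
    rw [unitTorusGeo_dist, tdistT_symm M b.1]
    exact exp_decay_mono hb hρB (tdistT_nonneg _ _ _)
  have key := hasMaj_comp3_plain (g := unitTorusGeo L k M) (triangle254_unitTorusGeo L k M) (unitTorusGeo_dist_nonneg L k M)
    (unitTorusGeo_dist_symm L k M) hσ.le hcr0 (rowSum_unitTorusGeo L k M hσ)
    (fun b : Tor M × Fin (d + 1) => b.1) (fun y' => (card_fibre_unitBond M y').le)
    (fun i : Tor (fine n M) × Fin (d + 1) => blockOf n M i.1) (fun y' => (card_fibre_fineBond n M y').le)
    (fun i : Tor (fine n M) × Fin (d + 1) => blockOf n M i.1)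
    (A := A) (C := covC L M (L ^ kk)) (K := wTranspose M n w B) ha hB₀ (mul_nonneg hw hb) hρ le_rfl hA' hC' hK'
  refine key.mono fun y y' => ?_
  rw [unitTorusGeo_dist]
  have hE : 0 ≤ Real.exp (-(ρ * tdistT M y y')) := Real.exp_nonneg _
  have h1 : 0 ≤ ((d + 1 : ℕ) : ℝ) * a * B4Sect5Proof.latticeConst (d + 1) σ := by positivity
  have h2 : 0 ≤ ((d + 1 : ℕ) : ℝ) * B₀ * B4Sect5Proof.latticeConst (d + 1) σ := by positivity
  have h3 : ((((d + 1) * n ^ (d + 1) : ℕ) : ℝ)) * (w * b₀) ≤ ((d + 1 : ℕ) : ℝ) * b₀ := by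
    rw [← mul_assoc]
    exact mul_le_mul_of_nonneg_right hbal hb
  exact mul_le_mul_of_nonneg_right (mul_le_mul_of_nonneg_left (mul_le_mul_of_nonneg_left h3 h2) h1) hE

variable {L : ℕ} [NeZero L]

/-- **THE FIVE PLAIN MAJORANTS OF THE U = 1 VECTOR PIECE, ONE UNIFORM `(β, δ_p)`.**  For `d + 1 ≥ 2`, `L ≥ 1` there are `β, δ_p > 0` such that for every unit torus
`Π ℤ∕M_ν` with `L ∣ M_ν`, all levels `k`, `m`, every direction `ν` and every `0 ≤ ρ ≤ δ_p`, on the carrier `unitTorusGeo L k M`: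
(G) the coarse piece `G = H_k·C^{(k)}·(η^{d+1}H_kᵀ)` (blocks `blkFine`), (G′) its fine twin at level `L^mL^k` (weight `η^{d+1}∕(L^m)^{d+1}`, blocks `blkFine ∘ kingPrV`),
(S) the source piece `G∂_ν* = H_k·C^{(k)}·(η^{d+1}(∂_νH_k)ᵀ)`, (D₁′) `∂′_νG′`, (D₃′) `(Δ′−∂′∂′*)G′` all have the block majorant `β·e^{−ρ|y−y′|_T}`.
[cite: King1986, (4.42) p.675 (the piece); Balaban1984PropagatorsI, (1.63) p.28, (1.69) p.29; Balaban1984PropagatorsII, (2.156) p.250, (2.52)–(2.55) pp.232–233] -/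
theorem hasMaj_plain_all (hd : 1 ≤ d) (hL : 1 ≤ L) :
    ∃ β δp : ℝ, 0 < β ∧ 0 < δp ∧ ∀ (M : Fin (d + 1) → ℕ) [∀ μ, NeZero (M μ)] (_ : ∀ i, L ∣ M i) (k m : ℕ) (ν : Fin (d + 1))
      {ρ : ℝ} (_ : 0 ≤ ρ) (_ : ρ ≤ δp),
      HasMaj (BlockNorm.ofBlocks (unitTorusGeo L k M) (blkFine L k M)) (BlockNorm.ofBlocks (unitTorusGeo L k M) (blkFine L k M))
          (reH M (L ^ k) ∘ₗ (covC L M (L ^ k) ∘ₗ wTranspose M (L ^ k) (rweight (d := d) L k) (reH M (L ^ k))))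
          (fun y y' => β * Real.exp (-(ρ * tdistT M y y')))
      ∧ HasMaj (BlockNorm.ofBlocks (unitTorusGeo L k M) (blkFine L k M ∘ kingPrV L k m M))
          (BlockNorm.ofBlocks (unitTorusGeo L k M) (blkFine L k M ∘ kingPrV L k m M))
          (reH M (L ^ m * L ^ k) ∘ₗ (covC L M (L ^ (k + m)) ∘ₗ
            wTranspose M (L ^ m * L ^ k) (rweight (d := d) L k / ((L : ℝ) ^ m) ^ (d + 1)) (reH M (L ^ m * L ^ k))))
          (fun y y' => β * Real.exp (-(ρ * tdistT M y y')))
      ∧ HasMaj (BlockNorm.ofBlocks (unitTorusGeo L k M) (blkFine L k M)) (BlockNorm.ofBlocks (unitTorusGeo L k M) (blkFine L k M))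
          (reH M (L ^ k) ∘ₗ (covC L M (L ^ k) ∘ₗ wTranspose M (L ^ k) (rweight (d := d) L k) (reD M (L ^ k) ν)))
          (fun y y' => β * Real.exp (-(ρ * tdistT M y y')))
      ∧ HasMaj (BlockNorm.ofBlocks (unitTorusGeo L k M) (blkFine L k M ∘ kingPrV L k m M))
          (BlockNorm.ofBlocks (unitTorusGeo L k M) (blkFine L k M ∘ kingPrV L k m M))
          (reD M (L ^ m * L ^ k) ν ∘ₗ (covC L M (L ^ (k + m)) ∘ₗ
            wTranspose M (L ^ m * L ^ k) (rweight (d := d) L k / ((L : ℝ) ^ m) ^ (d + 1)) (reH M (L ^ m * L ^ k))))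
          (fun y y' => β * Real.exp (-(ρ * tdistT M y y')))
      ∧ HasMaj (BlockNorm.ofBlocks (unitTorusGeo L k M) (blkFine L k M ∘ kingPrV L k m M))
          (BlockNorm.ofBlocks (unitTorusGeo L k M) (blkFine L k M ∘ kingPrV L k m M))
          (reLap M (L ^ m * L ^ k) ∘ₗ (covC L M (L ^ (k + m)) ∘ₗ
            wTranspose M (L ^ m * L ^ k) (rweight (d := d) L k / ((L : ℝ) ^ m) ^ (d + 1)) (reH M (L ^ m * L ^ k))))
          (fun y y' => β * Real.exp (-(ρ * tdistT M y y'))) := by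
  obtain ⟨B₀, δ₀, hB₀, hδ₀, HC⟩ := exists_abs_covC_single_le (d := d) hd hL
  obtain ⟨cF, δF, hcF, hδF, HF⟩ := exists_abs_reLap_single_le (d := d)
  have hL0 : L ≠ 0 := by omega
  have hpC : 0 < periodConst (kappa163 (d + 1)) d := B5Kernel166Decay.periodConst_pos (kappa163_pos _) d
  have hMG : 0 ≤ MG163 (d + 1) := B5Hk163Decay.MG163_nonneg _
  have hMD : 0 ≤ MD163 (d + 1) := (mul_nonneg_iff_of_pos_right hpC).mp (B5Hk163TorusHolderDecay.CdecD_nonneg (d := d))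
  have hδH : 0 < kappa163 (d + 1) / (d + 1) := div_pos (kappa163_pos _) (by positivity)
  -- the common constants: `a₀` dominates the three left∕right entry constants, `δ_p` is half the smallest decay rate
  set c₀ : ℝ := MG163 (d + 1) * periodConst (kappa163 (d + 1)) d with hc₀
  set cD : ℝ := MD163 (d + 1) * periodConst (kappa163 (d + 1)) d with hcD
  set a₀ : ℝ := c₀ + cD + cF with ha₀
  have hc₀0 : 0 ≤ c₀ := mul_nonneg hMG hpC.le
  have hcD0 : 0 ≤ cD := mul_nonneg hMD hpC.le
  have ha₀0 : 0 ≤ a₀ := by positivity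
  have hc₀a : c₀ ≤ a₀ := by rw [ha₀]; linarith [hcF.le]
  have hcDa : cD ≤ a₀ := by rw [ha₀]; linarith [hcF.le]
  have hcFa : cF ≤ a₀ := by rw [ha₀]; linarith
  set δp : ℝ := min (min (kappa163 (d + 1) / (d + 1)) δF) δ₀ / 2 with hδp
  have hδp0 : 0 < δp := half_pos (lt_min (lt_min hδH hδF) hδ₀)
  set Kσ : ℝ := B4Sect5Proof.latticeConst (d + 1) δp with hKσ
  have hKσ0 : 0 ≤ Kσ := B4Sect5Proof.latticeConst_nonneg (d + 1) hδp0.le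
  set β : ℝ := (((d + 1 : ℕ) : ℝ) * a₀ * Kσ) * ((((d + 1 : ℕ) : ℝ) * B₀ * Kσ) * (((d + 1 : ℕ) : ℝ) * a₀)) + 1 with hβ
  refine ⟨β, δp, by positivity, hδp0, ?_⟩
  intro M _ hLM k m ν ρ hρ hρp
  -- the window: `ρ + δ_p ≤ 2δ_p ≤` each decay rate
  have h2 : ρ + δp ≤ min (min (kappa163 (d + 1) / (d + 1)) δF) δ₀ := by rw [hδp] at hρp ⊢; linarith
  have hρH : ρ + δp ≤ kappa163 (d + 1) / (d + 1) := h2.trans ((min_le_left _ _).trans (min_le_left _ _))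
  have hρF : ρ + δp ≤ δF := h2.trans ((min_le_left _ _).trans (min_le_right _ _))
  have hρ0 : ρ + δp ≤ δ₀ := h2.trans (min_le_right _ _)
  -- entry decays with the common constant `a₀`
  have hH : ∀ (nn : ℕ) [NeZero nn] (b : Tor M × Fin (d + 1)) (i : Tor (fine nn M) × Fin (d + 1)),
      |reH M nn (Pi.single b 1) i| ≤ a₀ * Real.exp (-(kappa163 (d + 1) / (d + 1) * tdistT M (blockOf nn M i.1) b.1)) := fun nn _ b i =>
    (abs_reH_single_le M nn b i).trans (mul_le_mul_of_nonneg_right hc₀a (Real.exp_nonneg _))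
  have hD : ∀ (nn : ℕ) [NeZero nn] (b : Tor M × Fin (d + 1)) (i : Tor (fine nn M) × Fin (d + 1)),
      |reD M nn ν (Pi.single b 1) i| ≤ a₀ * Real.exp (-(kappa163 (d + 1) / (d + 1) * tdistT M (blockOf nn M i.1) b.1)) := fun nn _ b i =>
    (abs_reD_single_le M nn ν b i).trans (mul_le_mul_of_nonneg_right hcDa (Real.exp_nonneg _))
  have hF : ∀ (nn : ℕ) [NeZero nn] (b : Tor M × Fin (d + 1)) (i : Tor (fine nn M) × Fin (d + 1)),
      |reLap M nn (Pi.single b 1) i| ≤ a₀ * Real.exp (-(δF * tdistT M (blockOf nn M i.1) b.1)) := fun nn _ b i =>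
    (HF M nn b i).trans (mul_le_mul_of_nonneg_right hcFa (Real.exp_nonneg _))
  have hCk : ∀ (kk : ℕ) (b b' : Tor M × Fin (d + 1)), |covC L M (L ^ kk) (Pi.single b' 1) b| ≤ B₀ * Real.exp (-(δ₀ * tdistT M b.1 b'.1)) :=
    fun kk b b' => HC M hLM kk b b'
  -- the uniform bound `β` dominates the composite's constant
  have hmono : ∀ y y' : Tor M,
      (((d + 1 : ℕ) : ℝ) * a₀ * Kσ) * ((((d + 1 : ℕ) : ℝ) * B₀ * Kσ) * (((d + 1 : ℕ) : ℝ) * a₀)) * Real.exp (-(ρ * tdistT M y y'))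
        ≤ β * Real.exp (-(ρ * tdistT M y y')) := fun y y' =>
    mul_le_mul_of_nonneg_right (by rw [hβ]; linarith) (Real.exp_nonneg _)
  have hwk : 0 ≤ rweight (d := d) L k := rweight_nonneg L k
  have hwk' : 0 ≤ rweight (d := d) L k / ((L : ℝ) ^ m) ^ (d + 1) := div_nonneg hwk (pow_nonneg (pow_nonneg (Nat.cast_nonneg _) _) _)
  have hfine : blkFine L k M ∘ kingPrV L k m M = fun i' : Tor (fine (L ^ m * L ^ k) M) × Fin (d + 1) => blockOf (L ^ m * L ^ k) M i'.1 :=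
    blkFine_comp_kingPrV M L k m
  refine ⟨?_, ?_, ?_, ?_, ?_⟩
  · exact (hasMaj_plain_unitTorus (L := L) M k k (L ^ k) hB₀.le (hCk k) ha₀0 ha₀0 (hH (L ^ k)) (hH (L ^ k)) hwk
      (fineBond_weight_balance hL0 k) hδp0 hρ hρH hρH hρ0).mono hmono
  · rw [hfine]
    exact (hasMaj_plain_unitTorus (L := L) M k (k + m) (L ^ m * L ^ k) hB₀.le (hCk (k + m)) ha₀0 ha₀0 (hH (L ^ m * L ^ k))
      (hH (L ^ m * L ^ k)) hwk' (fineBond_weight_balance_fine hL0 k m) hδp0 hρ hρH hρH hρ0).mono hmono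
  · exact (hasMaj_plain_unitTorus (L := L) M k k (L ^ k) hB₀.le (hCk k) ha₀0 ha₀0 (hH (L ^ k)) (hD (L ^ k)) hwk
      (fineBond_weight_balance hL0 k) hδp0 hρ hρH hρH hρ0).mono hmono
  · rw [hfine]
    exact (hasMaj_plain_unitTorus (L := L) M k (k + m) (L ^ m * L ^ k) hB₀.le (hCk (k + m)) ha₀0 ha₀0 (hD (L ^ m * L ^ k))
      (hH (L ^ m * L ^ k)) hwk' (fineBond_weight_balance_fine hL0 k m) hδp0 hρ hρH hρH hρ0).mono hmono
  · rw [hfine]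
    exact (hasMaj_plain_unitTorus (L := L) M k (k + m) (L ^ m * L ^ k) hB₀.le (hCk (k + m)) ha₀0 ha₀0 (hF (L ^ m * L ^ k))
      (hH (L ^ m * L ^ k)) hwk' (fineBond_weight_balance_fine hL0 k m) hδp0 hρ hρF hρH hρ0).mono hmono

end Concrete

end Summit.QuantumFields.YangMills.BalabanUVNodes.N15.VectorPiece

end
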